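import Summits.Ventures.DiscreteObjects.Hadamard.ConferenceGraph333Order82
import Summits.Ventures.DiscreteObjects.Hadamard.ConferenceGraph333FixedConference

/-!
# Orders `33` and `88` in Aut(srg(333,166,82,83)): forced fixed-point counts of the powers (kernel)

Framing: lottery ticket; floor = certified bounds/negative ranges.  Cell pub-namedobj (venture DiscreteObjects),
target (H) = `H(668)`, hadamard gen 31.  Positive structure for two ADMISSIBLE element orders of the census (they are NOT excluded), read off
the cycle-length census kit (`aut_cycle_length_census`), the order-`11` window (`aut_order11_fixed`: `25` fixed points), the order-`3`
window, the `2`-power windows, `aut_order4_census` and the gen-31 involution window `f ≤ 149`: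
* **`aut_order33_census`** — `σ` of order `33`: `#Fix σ³ = 25` and either (`#Fix σ = 1`, `#Fix σ¹¹ = 45`) or (`#Fix σ = 7`, `#Fix σ¹¹ = 51`)
  (cycle types `33⁸·11⁴·3⁸·1¹` or `33⁸·11⁴·3⁶·1⁷`; the partial-Hadamard rank test of PAPER-SECTION-H-involutions-g31 §6 removes the second at
  the paper level — kernel instance pending, tool `IntertwinedTraceBound`);
* **`aut_order88_census`** — `σ` of order `88`: `#Fix σ = 1`, `#Fix σ⁸ = 25`, `#Fix σ¹¹ = 1` and **`#Fix σ⁴⁴ = 141`**: an element of order `88`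
  requires an involution with `141` fixed vertices (the window is `f ≤ 149`; an improvement to `f ≤ 137` would exclude order `88`).
WORDS: structure of a HYPOTHETICAL object (orders `33`, `88` remain admissible); ours (PROVISIONAL).  No `sorry`, no new definitions.
-/

namespace Summit.Ventures.DiscreteObjects.Hadamard

open Finset

section orders3388
variable {V : Type*} [Fintype V] [DecidableEq V]

/-- **Order `33`**: `#Fix σ³ = 25` and (`#Fix σ`, `#Fix σ¹¹`) ∈ {(1, 45), (7, 51)}. -/
theorem aut_order33_census (hV : Fintype.card V = 333) (A : Matrix V V ℤ)
    (h01 : ∀ x y, A x y = 0 ∨ A x y = 1) (hsymm : ∀ x y, A y x = A x y) (hdiag : ∀ x, A x x = 0)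
    (hk : ∀ x, ∑ y, A x y = 166) (hsrg : ∀ x y, ∑ z, A x z * A z y = 83 * (1 + (if x = y then 1 else 0)) - A x y)
    (σ : Equiv.Perm V) (hσ : σ ^ 33 = 1) (hσ11 : σ ^ 11 ≠ 1) (hσ3 : σ ^ 3 ≠ 1) (hA : ∀ x y, A (σ x) (σ y) = A x y) :
    (univ.filter fun x => (σ ^ 3) x = x).card = 25 ∧
    (((univ.filter fun x => σ x = x).card = 1 ∧ (univ.filter fun x => (σ ^ 11) x = x).card = 45) ∨
     ((univ.filter fun x => σ x = x).card = 7 ∧ (univ.filter fun x => (σ ^ 11) x = x).card = 51)) := by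
  have hAk := adj_pow_invariant A σ hA
  obtain ⟨c, h1, h2, -, h4, h6⟩ := aut_cycle_length_census hV A h01 hsymm hdiag hk hsrg σ hσ (by norm_num) hA
  have hD : Nat.divisors 33 = {1, 3, 11, 33} := by decide
  have f1 := h2 1
  have f3 := h2 3
  have f11 := h2 11
  have e3 := h6 3 (by norm_num)
  have e11 := h6 11 (by norm_num)
  have e33 := h6 33 (by norm_num)
  have o33 := h4 33 (by norm_num)
  rw [pow_one] at f1
  simp only [hD, Finset.sum_filter] at h1 f1 f3 f11
  norm_num at h1 f1 f3 f11
  rw [f1] at o33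
  -- σ³ has order 11: 25 fixed points
  have hp3 : (σ ^ 3) ^ 11 = 1 := by rw [← pow_mul]; exact hσ
  have w3 := aut_order11_fixed hV A h01 hsymm hdiag hk hsrg (σ ^ 3) hp3 hσ3 (hAk 3)
  rw [f3] at w3
  -- σ¹¹ has order 3: window f % 6 = 3, f ≤ 81
  have hp11 : (σ ^ 11) ^ 3 = 1 := by rw [← pow_mul]; exact hσ
  obtain ⟨w11, -, -, -, -, -, -, -, -, -⟩ :=
    aut_prime_windows_refined hV A h01 hsymm hdiag hk hsrg (by norm_num : Nat.Prime 3) (by norm_num) (σ ^ 11) hp11 hσ11 (hAk 11)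
  have hw11 := w11 rfl
  rw [f11] at hw11
  rw [f1, f3, f11]
  clear hAk h2 h4 h6 hD hA hsrg hk hdiag hsymm h01 hσ hp3 hp11 w11 f1 f3 f11
  rcases o33 with o | o <;> omega

/-- **Order `88`**: `#Fix σ = 1`, `#Fix σ⁸ = 25`, `#Fix σ¹¹ = 1`, `#Fix σ⁴⁴ = 141` — an involution with `141` fixed vertices is forced. -/
theorem aut_order88_census (hV : Fintype.card V = 333) (A : Matrix V V ℤ)
    (h01 : ∀ x y, A x y = 0 ∨ A x y = 1) (hsymm : ∀ x y, A y x = A x y) (hdiag : ∀ x, A x x = 0)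
    (hk : ∀ x, ∑ y, A x y = 166) (hsrg : ∀ x y, ∑ z, A x z * A z y = 83 * (1 + (if x = y then 1 else 0)) - A x y)
    (σ : Equiv.Perm V) (hσ : σ ^ 88 = 1) (hσ44 : σ ^ 44 ≠ 1) (hσ8 : σ ^ 8 ≠ 1) (hA : ∀ x y, A (σ x) (σ y) = A x y) :
    (univ.filter fun x => σ x = x).card = 1 ∧ (univ.filter fun x => (σ ^ 8) x = x).card = 25 ∧
      (univ.filter fun x => (σ ^ 11) x = x).card = 1 ∧ (univ.filter fun x => (σ ^ 44) x = x).card = 141 := by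
  have hAk := adj_pow_invariant A σ hA
  obtain ⟨c, h1, h2, -, h4, h6⟩ := aut_cycle_length_census hV A h01 hsymm hdiag hk hsrg σ hσ (by norm_num) hA
  have hD : Nat.divisors 88 = {1, 2, 4, 8, 11, 22, 44, 88} := by decide
  have f1 := h2 1
  have f8 := h2 8
  have f11 := h2 11
  have f22 := h2 22
  have f44 := h2 44
  have e2 := h6 2 (by norm_num)
  have e4 := h6 4 (by norm_num)
  have e8 := h6 8 (by norm_num)
  have e11 := h6 11 (by norm_num)
  have e22 := h6 22 (by norm_num)
  have e44 := h6 44 (by norm_num)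
  have e88 := h6 88 (by norm_num)
  have o88 := h4 88 (by norm_num)
  rw [pow_one] at f1
  simp only [hD, Finset.sum_filter] at h1 f1 f8 f11 f22 f44
  norm_num at h1 f1 f8 f11 f22 f44
  rw [f1] at o88
  -- σ⁸ has order 11: 25 fixed points
  have hp8 : (σ ^ 8) ^ 11 = 1 := by rw [← pow_mul]; exact hσ
  have w8 := aut_order11_fixed hV A h01 hsymm hdiag hk hsrg (σ ^ 8) hp8 hσ8 (hAk 8)
  rw [f8] at w8
  -- σ⁴⁴ is an involution: f ≡ 1 (mod 4), f ≤ 149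
  have hp44 : (σ ^ 44) ^ 2 = 1 := by rw [← pow_mul]; exact hσ
  have hinv44 : ∀ x, (σ ^ 44) ((σ ^ 44) x) = x := fun x => by
    have := congrArg (fun g : Equiv.Perm V => g x) hp44
    simpa [pow_two] using this
  obtain ⟨wm44, wl44⟩ := involution_window_149 hV A h01 hsymm hdiag hk hsrg (σ ^ 44) hinv44 hσ44 (hAk 44)
  rw [f44] at wm44 wl44
  -- σ¹¹ has order 8: f ≤ 40
  have hp11 : (σ ^ 11) ^ (2 ^ (2 + 1)) = 1 := by rw [← pow_mul]; exact hσ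
  have hne11 : (σ ^ 11) ^ (2 ^ 2) ≠ 1 := by rw [← pow_mul]; exact hσ44
  obtain ⟨-, w11, -, -, -, -, -⟩ := aut_two_power_windows hV A h01 hsymm hdiag hk hsrg (σ ^ 11) (hAk 11) 2 hp11 hne11
  have hw11 := w11 rfl
  rw [f11] at hw11
  -- σ²² has (σ²²)⁴ = 1: #Fix σ²² ≡ 1 (mod 4)
  have hp22 : (σ ^ 22) ^ 4 = 1 := by rw [← pow_mul]; exact hσ
  have h4c := aut_order4_census hV A h01 hsymm hdiag hk hsrg (σ ^ 22) hp22 (hAk 22)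
  have w22 := h4c.1
  rw [f22] at w22
  rw [f1, f8, f11, f44]
  clear hAk h2 h4 h6 hD hA hsrg hk hdiag hsymm h01 hσ hp8 hp44 hinv44 hp11 hne11 w11 hp22 h4c f1 f8 f11 f22 f44
  rcases o88 with o | o <;> omega

end orders3388

end Summit.Ventures.DiscreteObjects.Hadamard
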